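import Summits.ABC.ABC.Theses.TwistAmplification
import Summits.ABC.ABC.Theorems.TwistAmplificationSharpModerateLawCoreTransfer

noncomputable section
set_option linter.dupNamespace false

namespace Summit.ABC.ABC.Theorems.SharpModerateLaw

/-- **Twist-minimality** of a cusp pair `(c₄, c₆)`: no prime `p ≥ 5` is a twisting (`I₀*`) prime, i.e. whenever
`p² ∣ c₄` and `p³ ∣ c₆` the discriminant is deeper than a bare twist: `p⁷ ∣ c₄³ − c₆²` (for `p ≥ 5`,
`v_p(c₄³ − c₆²) = v_p(Δ)`).  Every tower-free pair is `(d²u, d³v)` for a unique squarefree `d` (product of its twisting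
primes) and a unique twist-minimal `(u, v)` with `gcd(d, 6Δ(u,v)) = 1`. -/
def IsTwistMinimal (x : ℤ × ℤ) : Prop :=
  ∀ p : ℕ, p.Prime → 5 ≤ p → (p : ℤ) ^ 2 ∣ x.1 → (p : ℤ) ^ 3 ∣ x.2 → (p : ℤ) ^ 7 ∣ x.1 ^ 3 - x.2 ^ 2

/-- **`CoreLawTM` — the canonical core on twist-minimal pairs** (the STATISTICAL summand of the crux): for all
`3 < κ₀ < σ` and `ε > 0` there is `C` with `#(cuspShell(X, Y) ∩ twist-minimal) ≤ C·(XY)^ε·(X·Y^{-1/6} + 1)` whenever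
`X^{κ₀} ≤ Y ≤ X^σ`.  Same shape as `CoreLaw`, one membership clause more. -/
def CoreLawTM : Prop :=
  ∀ κ₀ σ : ℝ, 3 < κ₀ → κ₀ < σ → ∀ ε : ℝ, 0 < ε → ∃ C : ℝ, ∀ X Y : ℝ, 1 ≤ X → 1 ≤ Y → X ^ κ₀ ≤ Y → Y ≤ X ^ σ →
    (Set.ncard {x : ℤ × ℤ | x ∈ cuspShell X Y ∧ IsTwistMinimal x} : ℝ) ≤
      C * (X * Y) ^ ε * (X * Y ^ (-(1 / 6 : ℝ)) + 1)

/-- **`PointwiseSzpiroCusp` — generalized Szpiro in cusp coordinates** (the POINTWISE summand of the crux; summit-equivalent: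
`ABC →` this via Bombieri–Gubler 12.5.12 `abcLe_iff_generalizedSzpiroBG_holds` and the realisation `y² = x³ − 27c₄x − 54c₆`
whose minimal model has prime-to-6 conductor exactly `N5cusp` and `f₂ ≤ 8`, `f₃ ≤ 5`; this `→ ABC` via the Frey pair of an abc
triple, for which `N5cusp ≤ rad(abc)` and `M⁺ ≥ c⁶/2`).  For every `η > 0` there is `C` with
`M⁺(c₄, c₆) ≤ C · N5cusp(c₄, c₆)^{6+η}` for every tower-free pair with `c₄c₆ ≠ 0`, `c₄³ ≠ c₆²`, `1728 ∣ c₄³ − c₆²`. -/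
def PointwiseSzpiroCusp : Prop :=
  ∀ η : ℝ, 0 < η → ∃ C : ℝ, ∀ x : ℤ × ℤ, x.1 ≠ 0 → x.2 ≠ 0 → x.1 ^ 3 ≠ x.2 ^ 2 → (1728 : ℤ) ∣ x.1 ^ 3 - x.2 ^ 2 →
    TF x → (Mcusp x : ℝ) ≤ C * (N5cusp x : ℝ) ^ (6 + η)

/-- **`TwistOrbitInversion`** (provable now, elementary): the twist-minimal core law and pointwise Szpiro give the full core law
back, by summing over the twist parameter (module docstring).  Statement only; proof is prover business. -/
def TwistOrbitInversion : Prop :=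
  CoreLawTM → PointwiseSzpiroCusp → CoreLaw

/-- **`CuspRealisation`** (provable now, size M): the catalogued generalized Szpiro conjecture (Bombieri–Gubler 12.5.11,
`GeneralizedSzpiroConjectureBG`, on minimal integral models) implies its cusp-coordinate form.  Proof sketch: a tower-free pair
`(u, v)` with `1728 ∣ u³ − v²`, `u³ ≠ v²` is realised by `y² = x³ − 27u·x − 54v` (invariants `(6⁴u, 6⁶v)`, `Δ = 6¹²·(u³−v²)/1728`);
tower-freeness at `p ≥ 5` is `p`-minimality, so a global minimal model differs by a `w ∣ 36` scaling; its conductor is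
`2^{f₂}3^{f₃}·N5cusp(u, v)` with `f₂ ≤ 8`, `f₃ ≤ 5` (`conductorExponent_le_eight_holds`, `…le_five…_holds`, `…le_two…` in
`Literature…Conductor*`), hence `M⁺(u,v) ≤ 6¹²·36¹²·C·(2⁸3⁵·N5cusp)^{6+η}`. -/
def CuspRealisation : Prop :=
  Literature.NumberTheory.EllipticCurves.GeneralizedSzpiroConjectureBG → PointwiseSzpiroCusp

/-- **The split glue, 3-child form** (kernel-checked): `CoreLawTM → PointwiseSzpiroCusp → TwistOrbitInversion → SharpModerateLaw`,
through the landed `sharpModerateLaw_of_coreLaw`. -/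
theorem sharpModerateLaw_of_twistMinimalSplit (h₁ : CoreLawTM) (h₂ : PointwiseSzpiroCusp)
    (h₃ : TwistOrbitInversion) : Summit.ABC.ABC.Theses.TwistAmplification.SharpModerateLaw :=
  sharpModerateLaw_of_coreLaw (h₃ h₁ h₂)

/-- **The split glue, 4-child form with the catalogued conjecture** (kernel-checked):
`CoreLawTM → GeneralizedSzpiroConjectureBG → CuspRealisation → TwistOrbitInversion → SharpModerateLaw`. -/
theorem sharpModerateLaw_of_twistMinimalSplitBG (h₁ : CoreLawTM)
    (h₂ : Literature.NumberTheory.EllipticCurves.GeneralizedSzpiroConjectureBG) (h₃ : CuspRealisation)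
    (h₄ : TwistOrbitInversion) : Summit.ABC.ABC.Theses.TwistAmplification.SharpModerateLaw :=
  sharpModerateLaw_of_coreLaw (h₄ h₁ (h₃ h₂))

/-- … and the summit, through `abc_of_coreLaw` (calibration: the children are jointly at least `ABC`). -/
theorem abc_of_twistMinimalSplit (h₁ : CoreLawTM) (h₂ : PointwiseSzpiroCusp) (h₃ : TwistOrbitInversion) :
    _root_.ABC :=
  abc_of_coreLaw (h₃ h₁ h₂)

/-- **The pointwise child IS the summit** (both directions landed in the tree: Bombieri–Gubler Thm 12.5.12 through
`moderateWindowCount_of_generalizedSzpiroBG`/`ModerateWindowCount.abc_of` and `ModerateWindowCount.generalizedSzpiroBG_of_abc`).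
[cite: BombieriGubler2006, Thm. 12.5.12] -/
theorem generalizedSzpiroBG_iff_abc :
    Literature.NumberTheory.EllipticCurves.GeneralizedSzpiroConjectureBG ↔ _root_.ABC :=
  ⟨fun h => ModerateWindowCount.abc_of (moderateWindowCount_of_generalizedSzpiroBG h),
    ModerateWindowCount.generalizedSzpiroBG_of_abc⟩

/-- **The crux implies the pointwise child** (`SharpModerateLaw → ABC → GeneralizedSzpiroConjectureBG`): together with
`coreLawTM_of_coreLaw` below, the split loses nothing but the (believed harmless) gap `CoreLaw ⇒ SharpModerateLaw`. -/
theorem generalizedSzpiroBG_of_sharpModerateLaw (h : Summit.ABC.ABC.Theses.TwistAmplification.SharpModerateLaw) :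
    Literature.NumberTheory.EllipticCurves.GeneralizedSzpiroConjectureBG :=
  ModerateWindowCount.generalizedSzpiroBG_of_abc (abc_of_sharpModerateLaw h)

/-- `CoreLaw → CoreLawTM`: the statistical child is formally weaker than the core (a sub-count of a finite shell). -/
theorem coreLawTM_of_coreLaw : CoreLaw → CoreLawTM := by
  intro h κ₀ σ hκ₀ hκσ ε hε
  obtain ⟨C, hC⟩ := h κ₀ σ hκ₀ hκσ ε hε
  refine ⟨C, fun X Y hX hY hlo hhi => le_trans ?_ (hC X Y hX hY hlo hhi)⟩
  exact_mod_cast Set.ncard_le_ncard (fun x (hx : x ∈ cuspShell X Y ∧ IsTwistMinimal x) => hx.1)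
    (cuspShell_finite_holds X Y)

/-- The twist action on cusp pairs: `d ⋆ (u, v) = (d²u, d³v)` (quadratic twist by `d` in `(c₄, c₆)` coordinates). -/
def twistPair (d : ℤ) (x : ℤ × ℤ) : ℤ × ℤ := (d ^ 2 * x.1, d ^ 3 * x.2)

/-- The discriminant numerator scales by `d⁶` under the twist action. -/
theorem twistPair_cube_sub_sq (d : ℤ) (x : ℤ × ℤ) :
    (twistPair d x).1 ^ 3 - (twistPair d x).2 ^ 2 = d ^ 6 * (x.1 ^ 3 - x.2 ^ 2) := by
  simp only [twistPair]; ring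

/-- A twist by `d` with a prime factor `p ≥ 5` not dividing `u³ − v²` is never twist-minimal (the twists produced by the
route's amplification lemma leave the twist-minimal population) — the reason `CoreLawTM` is blind to amplification. -/
theorem not_isTwistMinimal_twistPair {p : ℕ} (hp : p.Prime) (h5 : 5 ≤ p) {d : ℤ} (hpd : (p : ℤ) ∣ d) (x : ℤ × ℤ)
    (hx : ¬ (p : ℤ) ∣ x.1 ^ 3 - x.2 ^ 2) (hd : ¬ (p : ℤ) ^ 2 ∣ d) : ¬ IsTwistMinimal (twistPair d x) := by
  intro htm
  have hp' : Prime (p : ℤ) := Nat.prime_iff_prime_int.mp hp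
  obtain ⟨e, rfl⟩ := hpd
  have h2 : (p : ℤ) ^ 2 ∣ (twistPair (p * e) x).1 := ⟨e ^ 2 * x.1, by simp only [twistPair]; ring⟩
  have h3 : (p : ℤ) ^ 3 ∣ (twistPair (p * e) x).2 := ⟨e ^ 3 * x.2, by simp only [twistPair]; ring⟩
  have h7 := htm p hp h5 h2 h3
  rw [twistPair_cube_sub_sq] at h7
  -- `p⁷ ∣ p⁶ e⁶ (u³ − v²)` with `p ∤ e` (else `p² ∣ d`) and `p ∤ u³ − v²`: contradiction
  have hpe : ¬ (p : ℤ) ∣ e := by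
    rintro ⟨f, rfl⟩; exact hd ⟨f, by ring⟩
  have : (p : ℤ) ∣ e ^ 6 * (x.1 ^ 3 - x.2 ^ 2) := by
    have h7' : (p : ℤ) ^ 6 * (p : ℤ) ∣ (p : ℤ) ^ 6 * (e ^ 6 * (x.1 ^ 3 - x.2 ^ 2)) := by
      have : (p * e : ℤ) ^ 6 * (x.1 ^ 3 - x.2 ^ 2) = (p : ℤ) ^ 6 * (e ^ 6 * (x.1 ^ 3 - x.2 ^ 2)) := by ring
      rw [← pow_succ, ← this]; exact h7
    exact (mul_dvd_mul_iff_left (pow_ne_zero 6 hp'.ne_zero)).mp h7'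
  rcases hp'.dvd_or_dvd this with h | h
  · exact hpe (hp'.dvd_of_dvd_pow h)
  · exact hx h


end Summit.ABC.ABC.Theorems.SharpModerateLaw

namespace Summit.ABC.ABC.Theses.TwistAmplification
open scoped BigOperators Topology Manifold Classical MeasureTheory ProbabilityTheory Matrix InnerProductSpace ComplexConjugate ContinuousMap
open Filter Set Function TopologicalSpace MeasureTheory
open Literature.Abc

/-- child 1 (crux, statistical) -/
def CoreLawTM : Prop :=
  ∀ κ₀ σ : ℝ, 3 < κ₀ → κ₀ < σ → ∀ ε : ℝ, 0 < ε → ∃ C : ℝ, ∀ X Y : ℝ, 1 ≤ X → 1 ≤ Y → X ^ κ₀ ≤ Y → Y ≤ X ^ σ → (Set.ncard {x : ℤ × ℤ | (x.1 ≠ 0 ∧ x.2 ≠ 0 ∧ x.1 ^ 3 ≠ x.2 ^ 2 ∧ (1728 : ℤ) ∣ x.1 ^ 3 - x.2 ^ 2 ∧ ((∀ p : ℕ, p.Prime → 5 ≤ p → ¬ ((p : ℤ) ^ 4 ∣ x.1 ∧ (p : ℤ) ^ 6 ∣ x.2)) ∧ ¬ ((2 : ℤ) ^ 8 ∣ x.1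 ∧ (2 : ℤ) ^ 11 ∣ x.2) ∧ ¬ ((3 : ℤ) ^ 5 ∣ x.1 ∧ (3 : ℤ) ^ 9 ∣ x.2)) ∧ Y ≤ ((max ((x.1 ^ 3 - x.2 ^ 2) / 1728).natAbs (x.1.natAbs ^ 3) : ℕ) : ℝ) ∧ ((max ((x.1 ^ 3 - x.2 ^ 2) / 1728).natAbs (x.1.natAbs ^ 3) : ℕ) : ℝ) < 2 * Y ∧ ((∏ p ∈ ((x.1 ^ 3 - x.2 ^ 2) / 1728).natAbs.primeFactors with 5 ≤ p, (if ((p : ℕ) : ℤ) ∣ x.1 then p ^ 2 else p) : ℕ) : ℝ) ≤ X) ∧ (∀ p : ℕ, p.Prime → 5 ≤ p → (p : ℤ) ^ 2 ∣ x.1 → (p : ℤ) ^ 3 ∣ x.2 → (p : ℤ) ^ 7 ∣ x.1 ^ 3 - x.2 ^ 2)} : ℝ) ≤ C * (X * Y) ^ ε * (X * Y ^ (-(1 / 6 : ℝ)) + 1)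

/-- child 2 (crux, pointwise = summit): Bombieri–Gubler Conj. 12.5.11 verbatim -/
def GeneralizedSzpiro : Prop :=
  ∀ ε : ℝ, 0 < ε → ∃ C : ℝ, ∀ W₀ : WeierstrassCurve ℤ, (W₀.baseChange ℚ).IsElliptic → (∀ v : IsDedekindDomain.HeightOneSpectrum ℤ, (W₀.baseChange ℚ).IsMinimalAt v) → ((max |W₀.Δ| (|W₀.c₄| ^ 3) : ℤ) : ℝ) ≤ C * ((W₀.baseChange ℚ).conductorNorm ℤ : ℝ) ^ (6 + ε)

/-- child 3 (support): cusp realisation -/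
def CuspRealisation : Prop :=
  (∀ ε : ℝ, 0 < ε → ∃ C : ℝ, ∀ W₀ : WeierstrassCurve ℤ, (W₀.baseChange ℚ).IsElliptic → (∀ v : IsDedekindDomain.HeightOneSpectrum ℤ, (W₀.baseChange ℚ).IsMinimalAt v) → ((max |W₀.Δ| (|W₀.c₄| ^ 3) : ℤ) : ℝ) ≤ C * ((W₀.baseChange ℚ).conductorNorm ℤ : ℝ) ^ (6 + ε)) → (∀ η : ℝ, 0 < η → ∃ C : ℝ, ∀ x : ℤ × ℤ, x.1 ≠ 0 → x.2 ≠ 0 → x.1 ^ 3 ≠ x.2 ^ 2 → (1728 : ℤ) ∣ x.1 ^ 3 - x.2 ^ 2 → ((∀ p : ℕ, p.Prime → 5 ≤ p → ¬ ((p : ℤ) ^ 4 ∣ x.1 ∧ (p : ℤ) ^ 6 ∣ x.2)) ∧ ¬ ((2 : ℤ) ^ 8 ∣ x.1 ∧ (2 : ℤ) ^ 11 ∣ x.2) ∧ ¬ ((3 : ℤ) ^ 5 ∣ x.1 ∧ (3 : ℤ) ^ 9 ∣ x.2)) → (((max ((x.1 ^ 3 - x.2 ^ 2) / 1728).natAbs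 (x.1.natAbs ^ 3) : ℕ) : ℝ)) ≤ C * ((∏ p ∈ ((x.1 ^ 3 - x.2 ^ 2) / 1728).natAbs.primeFactors with 5 ≤ p, (if ((p : ℕ) : ℤ) ∣ x.1 then p ^ 2 else p) : ℕ) : ℝ) ^ (6 + η))

/-- child 4 (support): twist-orbit inversion -/
def TwistOrbitInversion : Prop :=
  (∀ κ₀ σ : ℝ, 3 < κ₀ → κ₀ < σ → ∀ ε : ℝ, 0 < ε → ∃ C : ℝ, ∀ X Y : ℝ, 1 ≤ X → 1 ≤ Y → X ^ κ₀ ≤ Y → Y ≤ X ^ σ → (Set.ncard {x : ℤ × ℤ | (x.1 ≠ 0 ∧ x.2 ≠ 0 ∧ x.1 ^ 3 ≠ x.2 ^ 2 ∧ (1728 : ℤ) ∣ x.1 ^ 3 - x.2 ^ 2 ∧ ((∀ p : ℕ, p.Prime → 5 ≤ p → ¬ ((p : ℤ) ^ 4 ∣ x.1 ∧ (p : ℤ) ^ 6 ∣ x.2)) ∧ ¬ ((2 : ℤ) ^ 8 ∣ x.1 ∧ (2 : ℤ) ^ 11 ∣ x.2) ∧ ¬ ((3 : ℤ) ^ 5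 ∣ x.1 ∧ (3 : ℤ) ^ 9 ∣ x.2)) ∧ Y ≤ ((max ((x.1 ^ 3 - x.2 ^ 2) / 1728).natAbs (x.1.natAbs ^ 3) : ℕ) : ℝ) ∧ ((max ((x.1 ^ 3 - x.2 ^ 2) / 1728).natAbs (x.1.natAbs ^ 3) : ℕ) : ℝ) < 2 * Y ∧ ((∏ p ∈ ((x.1 ^ 3 - x.2 ^ 2) / 1728).natAbs.primeFactors with 5 ≤ p, (if ((p : ℕ) : ℤ) ∣ x.1 then p ^ 2 else p) : ℕ) : ℝ) ≤ X) ∧ (∀ p : ℕ, p.Prime → 5 ≤ p → (p : ℤ) ^ 2 ∣ x.1 → (p : ℤ) ^ 3 ∣ x.2 → (p : ℤ) ^ 7 ∣ x.1 ^ 3 - x.2 ^ 2)} : ℝ) ≤ C * (X * Y) ^ ε * (X * Y ^ (-(1 / 6 : ℝ)) + 1)) → (∀ η : ℝ, 0 < η → ∃ C : ℝ, ∀ x : ℤ × ℤ, x.1 ≠ 0 → x.2 ≠ 0 → x.1 ^ 3 ≠ x.2 ^ 2 → (1728 : ℤ) ∣ x.1 ^ 3 - x.2 ^ 2 → ((∀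 p : ℕ, p.Prime → 5 ≤ p → ¬ ((p : ℤ) ^ 4 ∣ x.1 ∧ (p : ℤ) ^ 6 ∣ x.2)) ∧ ¬ ((2 : ℤ) ^ 8 ∣ x.1 ∧ (2 : ℤ) ^ 11 ∣ x.2) ∧ ¬ ((3 : ℤ) ^ 5 ∣ x.1 ∧ (3 : ℤ) ^ 9 ∣ x.2)) → (((max ((x.1 ^ 3 - x.2 ^ 2) / 1728).natAbs (x.1.natAbs ^ 3) : ℕ) : ℝ)) ≤ C * ((∏ p ∈ ((x.1 ^ 3 - x.2 ^ 2) / 1728).natAbs.primeFactors with 5 ≤ p, (if ((p : ℕ) : ℤ) ∣ x.1 then p ^ 2 else p) : ℕ) : ℝ) ^ (6 + η)) → (∀ κ₀ σ : ℝ, 3 < κ₀ → κ₀ < σ → ∀ ε : ℝ, 0 < ε → ∃ C : ℝ, ∀ X Y : ℝ, 1 ≤ X → 1 ≤ Y → X ^ κ₀ ≤ Y → Y ≤ X ^ σ → (Set.ncard {x : ℤ × ℤ | x.1 ≠ 0 ∧ x.2 ≠ 0 ∧ x.1 ^ 3 ≠ x.2 ^ 2 ∧ (1728 : ℤ) ∣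 x.1 ^ 3 - x.2 ^ 2 ∧ ((∀ p : ℕ, p.Prime → 5 ≤ p → ¬ ((p : ℤ) ^ 4 ∣ x.1 ∧ (p : ℤ) ^ 6 ∣ x.2)) ∧ ¬ ((2 : ℤ) ^ 8 ∣ x.1 ∧ (2 : ℤ) ^ 11 ∣ x.2) ∧ ¬ ((3 : ℤ) ^ 5 ∣ x.1 ∧ (3 : ℤ) ^ 9 ∣ x.2)) ∧ Y ≤ ((max ((x.1 ^ 3 - x.2 ^ 2) / 1728).natAbs (x.1.natAbs ^ 3) : ℕ) : ℝ) ∧ ((max ((x.1 ^ 3 - x.2 ^ 2) / 1728).natAbs (x.1.natAbs ^ 3) : ℕ) : ℝ) < 2 * Y ∧ ((∏ p ∈ ((x.1 ^ 3 - x.2 ^ 2) / 1728).natAbs.primeFactors with 5 ≤ p, (if ((p : ℕ) : ℤ) ∣ x.1 then p ^ 2 else p) : ℕ) : ℝ) ≤ X} : ℝ) ≤ C * (X * Y) ^ ε * (X * Y ^ (-(1 / 6 : ℝ)) + 1))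

example : CoreLawTM ↔ Summit.ABC.ABC.Theorems.SharpModerateLaw.CoreLawTM := Iff.rfl
example : GeneralizedSzpiro ↔ Literature.NumberTheory.EllipticCurves.GeneralizedSzpiroConjectureBG := Iff.rfl
example : CuspRealisation ↔ Summit.ABC.ABC.Theorems.SharpModerateLaw.CuspRealisation := Iff.rfl
example : TwistOrbitInversion ↔ Summit.ABC.ABC.Theorems.SharpModerateLaw.TwistOrbitInversion := Iff.rfl

/-- the glue item the split generates, closed by the Theorems-side theorem -/
theorem sharpModerateLaw_of_subs :
    CoreLawTM → GeneralizedSzpiro → CuspRealisation → TwistOrbitInversion → SharpModerateLaw :=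
  fun h₁ h₂ h₃ h₄ => Summit.ABC.ABC.Theorems.SharpModerateLaw.sharpModerateLaw_of_twistMinimalSplitBG h₁ h₂ h₃ h₄

end Summit.ABC.ABC.Theses.TwistAmplification
end
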